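import Literature.Barriers.QuantumAdvantage.PauliPathTruncationWorstCaseProofs
import HarnessLib

/-!
# Wide odd blocks: the GGCT truncation witness at every block width — no noise threshold below one
# in the block-layer presentation

THESIS (negation lens; a RECORD, not a barrier evasion).  The catalogued fact `pauliPathTruncation_worstCase` (GGCT
Lemma 5–6 / Thm 3: Hamming-weight truncation of the noisy Pauli path sum fails in the worst case for
`p < 1 − √(2/3) = 0.1835…`) is the width-3 member of a family.  NEW OBJECT: for any ODD Boolean gate `g` on `m` bits
(`g(¬c) = ¬g(c)`, the hypothesis `hg` is kept visible) the conditional complement `V_g` (`gateFlip`, `gate`) writes `g`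
into wire `i₀`; the witness is ONE layer `V_g^{⊗k}` on `|0^{mk}⟩` with observable `∏_i Z_{(i,i₀)}` and depolarizing
rate `p` before and after the layer (the tree's `PauliPath.noisyValue` / `truncValue`, depth-1 layer list
`wideLayers`).  LEVER: the level-1 Fourier sum `W₁(g) = Σ_i ĝ({i})` (`levelOne`).  RECORDS, for ALL `0 ≤ p ≤ 1`:
* T1 `noisyValue_eq`: `⟨O_k⟩_err = A_g(1−p)^k`, `|A_g(x)| ≤ x` (`blockGen`, `abs_blockGen_le`);
* T2 `truncValue_eq_zero` (`ℓ < 2k`) and `truncValue_eq`: `⟨O_k⟩_ℓ = (W₁(g)(1−p)²)^k` for `2k ≤ ℓ ≤ 2k+1` — every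
  cut-off `ℓ` is met by `k = ⌊ℓ/2⌋` blocks;
* T3 `truncation_floor`: `‖⟨O_k⟩_err − ⟨O_k⟩_ℓ‖ ≥ (W₁(g)(1−p)²)^k − (1−p)^k` (`truncation_floor_sub_one`: `… − 1`);
* T4 `levelOne_le_maj`: `W₁(g) ≤ W₁(Maj_m)` for every gate `g` — majority is the extremal block (O'Donnell Thm 2.33,
  re-proved here);
* T5 `levelOne_maj_eq`: `W₁(Maj_{2r+1}) = (2r+1)·C(2r,r)/4^r` (`= 3/2, 15/8, 35/16, 315/128`: `levelOne_maj_values`)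
  and the growth `W₁(Maj_{2r+1})² ≥ r+1` (`levelOne_maj_sq_ge`);
* T6 `noise_edges` (`norm_num`/`nlinarith` on closed rationals only): `W₁(Maj_m)(1−p)² > 1` for every `p ≤ 0.1835`
  (`m = 3`), `p ≤ 0.2697` (`m = 5`), `p ≤ 0.3238` (`m = 7`), `p ≤ 0.3625` (`m = 9`); the mutant `0.2697 → 0.2698` fails;
* T7 `wide_majority_no_threshold`: for every `p < 1` and every odd `m = 2r+1` with `(r+1)(1−p)⁴ > 1` the base exceeds
  one and for EVERY cut-off `ℓ` the error on `n = m⌊ℓ/2⌋` qubits is `≥ base^{⌊ℓ/2⌋} − 1` ("`2^{Ω(ℓ)}`" in words only).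
The width-3 member IS GGCT's circuit (`gate_maj_three`, `wideLayers_maj_three`, by `decide`/`rfl`), so
`width_three_floor` states the floor for the tree's own `GGCT.layers k`, `input k`, `obs k`: the barrier constant
`1 − √(2/3)` is recovered as the width-3 case, including the new cut-offs `ℓ ∈ {2k, 2k+1}` (the fact
`pauliPathTruncation_worstCase` keeps its window `2k < ℓ ≤ 9k/4`; it is cited BY NAME, never weakened or restated).
Cheapest falsifier, in-file: `blockGen (maj 5) x = (15x² − 10x⁴ + 3x⁶)/8` against the window value `(15/8)x²`.

HONEST SCOPE.  A worst-case failure FAMILY for ONE estimator (Hamming-weight truncation of the noisy path sum) in ONE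
presentation (an `m`-qubit permutation read as ONE layer with depolarizing noise before/after).  `1 − √(2/3)` is the
width-3 constant of this construction, not a threshold of the block-layer presentation.  No contradiction with
`PauliPathNoisyMass` (L-68, N4/N6): its diamond constant `1 − 2^{−1/2} = 0.2929…` excludes growth for presentations by
Clifford and SINGLE-rotation layers with noise after EVERY layer; a wide block read as one layer is outside that class,
and other presentations — e.g. decompositions of `V_g` into 2-qubit gates with noise after each — change the damping
count, so the numbers above belong to the block-layer presentation only.  The circuits are permutations applied to
`|0…0⟩` (trivially simulable otherwise); nothing here concerns hardness, simulability, spoofing, samplers or devices;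
no summit statement (`Summit.QuantumAdvantage*`) is touched; BQP vs BPP untouched.  Expected grade: VARIANT · RECORD.

Nearest print (credited): [GonzalezGarciaCiracTrivedi2025PauliPathBeyondAverageQuantum] Lemma 5, 6 (i)(ii)(v), 7,
Thm 3 (width 3 only; §7 makes no remark on wider gates); [ODonnell2014] Prop 2.31 / Ex 2.22 (`I[Maj_n]`), Thm 2.33
(majority maximises `Σ_i f̂(i)`).  The family `V_g`, T2's cut-offs and T4–T7 as truncation statements: no print found
(corpus fts + vec and galaxy; queries listed in the cell SKETCH).
-/

noncomputable section

open Matrix Finset Complex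

namespace Literature.Computability.QuantumComplexity

namespace WideMajorityTruncation

open PauliPath
open Literature.Barriers.QuantumAdvantage
open Literature.Barriers.QuantumAdvantage.GGCT

variable {m : ℕ}

/-! ### §1 Odd gates and the conditional-complement block -/

/-- The **conditional complement** of a basis label: keep `c` if its bit `i₀` already equals `g c`, otherwise complement every bit. For `m = 3`, `g = MAJ₃`, `i₀ = 0` this is GGCT's `|100⟩ ↔ |011⟩`. [cite: GonzalezGarciaCiracTrivedi2025PauliPathBeyondAverageQuantum, Lemma 5 (the gate V: V|100⟩ = |011⟩, V|011⟩ = |100⟩, other labels fixed)] -/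
def gateFlip (g : (Fin m → Bool) → Bool) (i₀ : Fin m) (c : Fin m → Bool) : Fin m → Bool :=
  if c i₀ = g c then c else fun j => !c j

/-- **The block writes the gate value into wire `i₀`**: `(flip c)_{i₀} = g(c)`. [cite: GonzalezGarciaCiracTrivedi2025PauliPathBeyondAverageQuantum, Lemma 5 ("V … implements majority voting")] -/
theorem gateFlip_apply_out (g : (Fin m → Bool) → Bool) (i₀ : Fin m) (c : Fin m → Bool) :
    gateFlip g i₀ c i₀ = g c := by
  unfold gateFlip
  split_ifs with h
  exacts [h, by cases hc : c i₀ <;> cases hg : g c <;> simp_all]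

/-- For an odd gate the conditional complement is an involution. [cite: GonzalezGarciaCiracTrivedi2025PauliPathBeyondAverageQuantum, Lemma 5 (V is a permutation of order 2)] -/
theorem gateFlip_gateFlip {g : (Fin m → Bool) → Bool} (hg : ∀ c : Fin m → Bool, g (fun j => !c j) = !g c) (i₀ : Fin m) (c : Fin m → Bool) :
    gateFlip g i₀ (gateFlip g i₀ c) = c := by
  unfold gateFlip
  by_cases h : c i₀ = g c
  · rw [if_pos h, if_pos h]
  · have h' : ¬ ((fun j => !c j) i₀ = g (fun j => !c j)) := by
      rw [hg c]; intro h2; apply h; cases hc : c i₀ <;> cases hgc : g c <;> simp_all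
    rw [if_neg h, if_neg h']; funext j; simp

/-- The conditional complement of an odd gate is injective. [folklore] -/
private theorem gateFlip_injective {g : (Fin m → Bool) → Bool} (hg : ∀ c : Fin m → Bool, g (fun j => !c j) = !g c) (i₀ : Fin m) :
    Function.Injective (gateFlip g i₀) := fun a b h => by
  simpa [gateFlip_gateFlip hg] using congrArg (gateFlip g i₀) h

/-- The **block gate `V_g`** as a `2^m × 2^m` permutation matrix: `V|b⟩ = |flip b⟩`. [cite: GonzalezGarciaCiracTrivedi2025PauliPathBeyondAverageQuantum, Lemma 5 (the gate V)] -/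
def gate (g : (Fin m → Bool) → Bool) (i₀ : Fin m) : Matrix (Fin m → Bool) (Fin m → Bool) ℂ :=
  Matrix.of fun a b => if a = gateFlip g i₀ b then 1 else 0

/-- Entries of `gate`. [cite: GonzalezGarciaCiracTrivedi2025PauliPathBeyondAverageQuantum, Lemma 5] -/
@[simp] theorem gate_apply (g : (Fin m → Bool) → Bool) (i₀ : Fin m) (a b : Fin m → Bool) :
    gate g i₀ a b = if a = gateFlip g i₀ b then 1 else 0 := rfl

/-- The **one-layer circuit `V_g^{⊗k}`** on the register `Fin k × Fin m` (block, wire), as a depth-`1` layer sequence for `PauliPath.noisyValue`. [cite: GonzalezGarciaCiracTrivedi2025PauliPathBeyondAverageQuantum, Lemma 5 (𝒞 = V^{⊗n/3}, "a single layer of 3-qubit unitaries")] -/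
def wideLayers (g : (Fin m → Bool) → Bool) (i₀ : Fin m) (k : ℕ) :
    Fin 1 → Matrix (Fin k × Fin m → Bool) (Fin k × Fin m → Bool) ℂ :=
  fun _ => blockTensor fun _ : Fin k => gate g i₀

/-- The observable `O_k`: Pauli `Z` on wire `i₀` of every block, identity elsewhere. [cite: GonzalezGarciaCiracTrivedi2025PauliPathBeyondAverageQuantum, Lemma 5 (O_k = ∏_i Z_{3i−2})] -/
def wideObs (i₀ : Fin m) (k : ℕ) : Fin k × Fin m → Pauli :=
  fun w => if w.2 = i₀ then Pauli.Z else Pauli.I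

/-- The input `(|0⟩⟨0|)^{⊗km}`. [cite: GonzalezGarciaCiracTrivedi2025PauliPathBeyondAverageQuantum, Lemma 5 (ρ_0)] -/
def wideInput (m k : ℕ) : Matrix (Fin k × Fin m → Bool) (Fin k × Fin m → Bool) ℂ :=
  proj fun _ => false

/-! ### §2 The block conjugation law `V_g† Z_{i₀} V_g = diag (−1)^{g}` -/

/-- The sign `(−1)^b` of a bit, as a real number. [folklore] -/
def sgn (b : Bool) : ℝ := if b then -1 else 1

/-- `(−1)^b` as a complex number. [folklore] -/
private theorem sgn_cast (b : Bool) : ((sgn b : ℝ) : ℂ) = if b then -1 else 1 := by cases b <;> simp [sgn]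

/-- `(−1)^{¬b} = −(−1)^b`. [folklore] -/
private theorem sgn_not (b : Bool) : sgn (!b) = -sgn b := by cases b <;> simp [sgn]

/-- `|(−1)^b| = 1`. [folklore] -/
private theorem abs_sgn (b : Bool) : |sgn b| = 1 := by cases b <;> simp [sgn]

/-- The block pattern `Z` at wire `i₀`, `I` elsewhere. [cite: GonzalezGarciaCiracTrivedi2025PauliPathBeyondAverageQuantum, Lemma 5 (Z_1 per block)] -/
def zAt (i₀ : Fin m) : Fin m → Pauli := fun j => if j = i₀ then Pauli.Z else Pauli.I

/-- `wideObs` is `zAt i₀` on every block. [cite: GonzalezGarciaCiracTrivedi2025PauliPathBeyondAverageQuantum, Lemma 5 (O_k)] -/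
theorem wideObs_eq_blocks (i₀ : Fin m) (k : ℕ) (w : Fin k × Fin m) : wideObs i₀ k w = zAt i₀ w.2 := rfl

/-- A `Z`-type string (letters in `{I, Z}`) is diagonal with entries `±1`. [folklore] -/
private theorem pauliString_apply_of_IZ {μ : Type*} [Fintype μ] (b : μ → Pauli)
    (hb : ∀ j, b j = Pauli.I ∨ b j = Pauli.Z) (c d : μ → Bool) :
    pauliString b c d = if c = d then ∏ j, (if b j = Pauli.Z ∧ c j then (-1 : ℂ) else 1) else 0 := by
  rw [pauliString_eq, tensorAll_apply]
  by_cases hcd : c = d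
  · subst hcd; rw [if_pos rfl]
    exact Finset.prod_congr rfl fun j _ => by rcases hb j with h | h <;> simp [h]
  · rw [if_neg hcd]
    obtain ⟨j, hj⟩ : ∃ j, c j ≠ d j := by by_contra h; push Not at h; exact hcd (funext h)
    exact Finset.prod_eq_zero (Finset.mem_univ j) (by rcases hb j with h | h <;> simp [h, hj])

/-- `zAt i₀` is a `Z`-type string. [folklore] -/
private theorem zAt_IZ (i₀ j : Fin m) : zAt i₀ j = Pauli.I ∨ zAt i₀ j = Pauli.Z := by unfold zAt; split_ifs <;> simp

/-- Entries of `Z_{i₀}`: diagonal, `(−1)^{c_{i₀}}`. [cite: GonzalezGarciaCiracTrivedi2025PauliPathBeyondAverageQuantum, Lemma 5 (Z_1)] -/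
theorem pauliString_zAt_apply (i₀ : Fin m) (c d : Fin m → Bool) :
    pauliString (zAt i₀) c d = if c = d then ((sgn (c i₀) : ℝ) : ℂ) else 0 := by
  rw [pauliString_apply_of_IZ (zAt i₀) (zAt_IZ i₀)]
  split_ifs with h
  · rw [sgn_cast, ← Finset.prod_erase_mul _ _ (Finset.mem_univ i₀), Finset.prod_eq_one fun j hj => ?_]
    · simp [zAt]
    · simp [zAt, (Finset.mem_erase.1 hj).1]
  · rfl

/-- **`V_g† Z_{i₀} V_g` is the diagonal `(−1)^{g}`** (the block writes `g` into wire `i₀`; for MAJ₃ this is "`V†(Z_1)V = (Z_1+Z_2+Z_3)/2 − Z_1Z_2Z_3/2`" = `diag (−1)^{MAJ}`). [cite: GonzalezGarciaCiracTrivedi2025PauliPathBeyondAverageQuantum, Lemma 5 (display for V†(Z_1)V)] -/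
theorem gate_conj_zAt_apply {g : (Fin m → Bool) → Bool} (hg : ∀ c : Fin m → Bool, g (fun j => !c j) = !g c) (i₀ : Fin m) (a b : Fin m → Bool) :
    ((gate g i₀)ᴴ * pauliString (zAt i₀) * gate g i₀) a b =
      if a = b then ((sgn (g a) : ℝ) : ℂ) else 0 := by
  rw [Matrix.mul_apply]
  have inner : ∀ d : Fin m → Bool, ((gate g i₀)ᴴ * pauliString (zAt i₀)) a d =
      if d = gateFlip g i₀ a then ((sgn (d i₀) : ℝ) : ℂ) else 0 := by
    intro d; rw [Matrix.mul_apply]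
    simp only [Matrix.conjTranspose_apply, gate_apply, pauliString_zAt_apply]
    rw [Finset.sum_eq_single (gateFlip g i₀ a)]
    · by_cases hd : d = gateFlip g i₀ a
      · subst hd; simp
      · rw [if_neg (Ne.symm hd), if_neg hd]; simp
    · intro c _ hc; rw [if_neg hc]; simp
    · intro h; exact absurd (Finset.mem_univ _) h
  simp only [inner, gate_apply]
  rw [Finset.sum_eq_single (gateFlip g i₀ a)]
  · simp only [if_true, gateFlip_apply_out]
    by_cases hab : a = b
    · subst hab; simp
    · rw [if_neg hab, if_neg]
      · simp
      · intro h; exact hab (gateFlip_injective hg i₀ h)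
  · intro d _ hd; rw [if_neg hd]; simp
  · intro h; exact absurd (Finset.mem_univ _) h

/-- The block transition bracket `Tr(Z_{i₀} · V_g b V_g†)` of a block input string `b`. [cite: GonzalezGarciaCiracTrivedi2025PauliPathBeyondAverageQuantum, §3 (f(s): tr(s_d U_d s_{d−1} U_d†)) and Lemma 5] -/
def blockAmp (g : (Fin m → Bool) → Bool) (i₀ : Fin m) (b : Fin m → Pauli) : ℂ :=
  (pauliString (zAt i₀) * (gate g i₀ * pauliString b * (gate g i₀)ᴴ)).trace

/-- **The bracket as a character sum**: `Tr(Z_{i₀} · V_g b V_g†) = Σ_c (−1)^{g(c)} ⟨c|b|c⟩`. [cite: GonzalezGarciaCiracTrivedi2025PauliPathBeyondAverageQuantum, Lemma 5 (proof)] -/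
theorem blockAmp_eq {g : (Fin m → Bool) → Bool} (hg : ∀ c : Fin m → Bool, g (fun j => !c j) = !g c) (i₀ : Fin m) (b : Fin m → Pauli) :
    blockAmp g i₀ b = ∑ c : Fin m → Bool, ((sgn (g c) : ℝ) : ℂ) * pauliString b c c := by
  have hcyc : blockAmp g i₀ b = ((gate g i₀)ᴴ * pauliString (zAt i₀) * gate g i₀ * pauliString b).trace := by
    rw [blockAmp, Matrix.mul_assoc (gate g i₀)ᴴ, Matrix.mul_assoc (gate g i₀)ᴴ, Matrix.trace_mul_comm (gate g i₀)ᴴ]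
    simp only [Matrix.mul_assoc]
  have hdiag : ∀ c : Fin m → Bool, ((gate g i₀)ᴴ * pauliString (zAt i₀) * gate g i₀ * pauliString b) c c =
      ((sgn (g c) : ℝ) : ℂ) * pauliString b c c := by
    intro c; rw [Matrix.mul_apply]
    simp only [gate_conj_zAt_apply hg, ite_mul, zero_mul, Finset.sum_ite_eq, Finset.mem_univ, if_true]
  rw [hcyc, Matrix.trace]
  simp only [Matrix.diag_apply, hdiag]

/-- The **block weight** `τ_g(b) = 2^{−m} Tr(Z_{i₀}·V_g b V_g†)·⟨0…0|b|0…0⟩` of a block input string. [cite: GonzalezGarciaCiracTrivedi2025PauliPathBeyondAverageQuantum, Lemma 5 (F_2 = 3/2, F_4 = −1/2 per block)] -/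
def blockCoeff (g : (Fin m → Bool) → Bool) (i₀ : Fin m) (b : Fin m → Pauli) : ℂ :=
  ((2 : ℂ) ^ m)⁻¹ * blockAmp g i₀ b * pauliString b (fun _ => false) (fun _ => false)

/-! ### §3 The path sum of the witness, block by block -/

section PathSum

variable (g : (Fin m → Bool) → Bool) (i₀ : Fin m)

/-- Entries of `blockTensor` (the tree's definition, restated for rewriting). [folklore] -/
private theorem blockTensor_apply' {κ μ : Type*} [Fintype κ] (A : κ → Matrix (μ → Bool) (μ → Bool) ℂ)
    (x y : κ × μ → Bool) : blockTensor A x y = ∏ i, A i (fun j => x (i, j)) (fun j => y (i, j)) := rfl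

/-- Sums over the product register factor through currying. [folklore] -/
private theorem sum_curry {κ μ γ β : Type*} [Fintype κ] [DecidableEq κ] [Fintype μ] [DecidableEq μ] [Fintype γ]
    [DecidableEq γ] [AddCommMonoid β] (G : (κ × μ → γ) → β) :
    ∑ z : κ × μ → γ, G z = ∑ z : κ → μ → γ, G (fun w => z w.1 w.2) :=
  Fintype.sum_equiv (Equiv.curry κ μ γ) _ _ fun _ => rfl

/-- The observable is the block tensor of `Z_{i₀}`. [cite: GonzalezGarciaCiracTrivedi2025PauliPathBeyondAverageQuantum, Lemma 5 (O_k)] -/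
theorem pauliString_wideObs (k : ℕ) :
    pauliString (wideObs i₀ k) = blockTensor fun _ : Fin k => pauliString (zAt i₀) := by
  rw [pauliString_eq_blockTensor]; rfl

/-- `|Z_{i₀}| = 1`. [cite: GonzalezGarciaCiracTrivedi2025PauliPathBeyondAverageQuantum, Lemma 5] -/
theorem strWeight_zAt : strWeight (zAt i₀) = 1 := by
  rw [strWeight_eq, Finset.card_eq_one]
  exact ⟨i₀, by ext j; simp [zAt]⟩

/-- `|O_k| = k`. [cite: GonzalezGarciaCiracTrivedi2025PauliPathBeyondAverageQuantum, Lemma 5 (O_k)] -/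
theorem strWeight_wideObs (k : ℕ) : strWeight (wideObs i₀ k) = k := by
  rw [strWeight_eq_sum_blocks]
  simp [wideObs_eq_blocks, strWeight_zAt]

/-- **The transition amplitude of the layer factorises over the blocks**: `Tr(O_k · V^{⊗k} a (V^{⊗k})†) = ∏_i Tr(Z_{i₀} · V a_i V†)`. [cite: GonzalezGarciaCiracTrivedi2025PauliPathBeyondAverageQuantum, Lemma 5 (proof, blockwise computation)] -/
theorem transAmp_wideLayer (k : ℕ) (a : Fin k × Fin m → Pauli) :
    transAmp 0 (blockTensor fun _ : Fin k => gate g i₀) a (wideObs i₀ k) = ∏ i, blockAmp g i₀ fun j => a (i, j) := by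
  rw [transAmp, depolarizeAll_rate_zero, pauliString_wideObs, pauliString_eq_blockTensor a,
    conjTranspose_blockTensor, blockTensor_mul, blockTensor_mul, blockTensor_mul, trace_blockTensor]; rfl

/-- The input bracket factorises over the blocks: `Tr(a ρ_0) = ∏_i ⟨0…0|a_i|0…0⟩`. [cite: GonzalezGarciaCiracTrivedi2025PauliPathBeyondAverageQuantum, Lemma 5 (ρ_0 = (|0⟩⟨0|)^{⊗n})] -/
theorem trace_pauliString_mul_wideInput (k : ℕ) (a : Fin k × Fin m → Pauli) :
    (pauliString a * wideInput m k).trace =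
      ∏ i, pauliString (fun j => a (i, j)) (fun _ => false) (fun _ => false) := by
  rw [wideInput, Matrix.trace_mul_comm, trace_proj_mul, pauliString_eq_blockTensor, blockTensor_apply']

/-- `2^{km} = (2^m)^k` on the register. [folklore] -/
private theorem two_pow_card_register (k : ℕ) : (2 : ℂ) ^ Fintype.card (Fin k × Fin m) = ((2 : ℂ) ^ m) ^ k := by
  rw [Fintype.card_prod, Fintype.card_fin, Fintype.card_fin, mul_comm, pow_mul]

/-- `|(s_0, s_1)| = |s_0| + |s_1|`. [cite: GonzalezGarciaCiracTrivedi2025PauliPathBeyondAverageQuantum, §3 (|s| = |s_0| + ⋯ + |s_d|)] -/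
theorem pathWeight_pair (k : ℕ) (a b : Fin k × Fin m → Pauli) :
    pathWeight (Fin.snoc (fun _ : Fin 1 => a) b : Fin (1 + 1) → Fin k × Fin m → Pauli) =
      strWeight a + strWeight b := by
  rw [pathWeight_eq, Fin.sum_univ_two]; rfl

/-- **The depth-one path coefficient of the witness, block by block**: `f̃(s_0, s_1)` vanishes unless `s_1 = O_k`, and then equals `(1−p)^{|s_0|+k} 2^{−mk} ∏_i Tr(Z_{i₀}·V (s_0)_i V†)·⟨0|(s_0)_i|0⟩`. [cite: GonzalezGarciaCiracTrivedi2025PauliPathBeyondAverageQuantum, §3 (f(s) = 2^{−n(d+1)} tr(O s_d) tr(s_d U_d s_{d−1} U_d†) ⋯ tr(s_0 ρ_0)) and Lemma 5] -/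
theorem pathCoeff_pair (p : ℂ) (k : ℕ) (a b : Fin k × Fin m → Pauli) :
    pathCoeff p (wideLayers g i₀ k) (wideInput m k) (pauliString (wideObs i₀ k)) (Fin.snoc (fun _ : Fin 1 => a) b) =
      if wideObs i₀ k = b then (1 - p) ^ (strWeight a + k) * ((((2 : ℂ) ^ m) ^ k)⁻¹ *
        ((∏ i, blockAmp g i₀ fun j => a (i, j)) *
          ∏ i, pauliString (fun j => a (i, j)) (fun _ => false) (fun _ => false))) else 0 := by
  rw [pathCoeff_eq_pow_mul_pathCoeff_zero, pathWeight_pair, pathCoeff]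
  have h1 : (Fin.snoc (fun _ : Fin 1 => a) b : Fin (1 + 1) → Fin k × Fin m → Pauli) (Fin.last 1) = b := rfl
  have h2 : (Fin.snoc (fun _ : Fin 1 => a) b : Fin (1 + 1) → Fin k × Fin m → Pauli) (Fin.castSucc 0) = a := rfl
  have h3 : (Fin.snoc (fun _ : Fin 1 => a) b : Fin (1 + 1) → Fin k × Fin m → Pauli) (Fin.succ 0) = b := rfl
  have h4 : (Fin.snoc (fun _ : Fin 1 => a) b : Fin (1 + 1) → Fin k × Fin m → Pauli) 0 = a := rfl
  simp only [Fin.prod_univ_one, h1, h2, h3, h4, depolarizeAll_rate_zero, trace_pauliString_mul_pauliString,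
    wideLayers, trace_pauliString_mul_wideInput, two_pow_card_register]
  split_ifs with h
  · subst h
    rw [transAmp_wideLayer, strWeight_wideObs]
    have hB0 : ((2 : ℂ) ^ m) ^ k ≠ 0 := pow_ne_zero _ (pow_ne_zero _ (by norm_num))
    rw [show (1 + 1 : ℕ) = 2 from rfl, inv_pow]
    generalize (∏ i, blockAmp g i₀ fun j => a (i, j)) = X
    generalize (∏ i, pauliString (fun j => a (i, j)) (fun _ => false) fun _ => false) = Y
    generalize hB : ((2 : ℂ) ^ m) ^ k = B
    rw [hB] at hB0
    rw [pow_two, mul_inv, mul_assoc B X Y, ← mul_assoc (B⁻¹ * B⁻¹) B, mul_assoc B⁻¹ B⁻¹ B,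
      inv_mul_cancel₀ hB0, mul_one]
  · simp

/-- **The filtered path sum of the witness, block by block**: for any weight predicate `P`, `Σ_{s : P|s|} f̃(s) = Σ_{β : blocks} [P(Σᵢ(|βᵢ|+1))] ∏ᵢ (1−p)^{|βᵢ|+1} τ_g(βᵢ)`. [cite: GonzalezGarciaCiracTrivedi2025PauliPathBeyondAverageQuantum, §3 (⟨O⟩_ℓ = Σ_{w ≤ ℓ} F_w(1−p)^w, Error = |Σ_{w>ℓ} F_w (1−p)^w|) and Lemma 6] -/
theorem filter_sum_pathCoeff_eq (p : ℂ) (k : ℕ) (P : ℕ → Prop) [DecidablePred P] :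
    ∑ s ∈ Finset.univ.filter (fun s : Fin (1 + 1) → Fin k × Fin m → Pauli => P (pathWeight s)),
        pathCoeff p (wideLayers g i₀ k) (wideInput m k) (pauliString (wideObs i₀ k)) s =
      ∑ β : Fin k → Fin m → Pauli, if P (∑ i, (strWeight (β i) + 1)) then
        ∏ i, ((1 - p) ^ (strWeight (β i) + 1) * blockCoeff g i₀ (β i)) else 0 := by
  rw [Finset.sum_filter, sum_path_two, Finset.sum_eq_single (wideObs i₀ k)]
  · simp only [pathCoeff_pair, pathWeight_pair, if_true, strWeight_wideObs]; rw [sum_curry]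
    refine Finset.sum_congr rfl fun β _ => ?_
    have hw : strWeight (fun w : Fin k × Fin m => β w.1 w.2) + k = ∑ i, (strWeight (β i) + 1) := by
      rw [strWeight_eq_sum_blocks, Finset.sum_add_distrib, Finset.sum_const, Finset.card_univ,
        Fintype.card_fin, smul_eq_mul, mul_one]
    rw [hw]; split_ifs with hP
    · rw [← Finset.prod_pow_eq_pow_sum, Finset.prod_mul_distrib]
      simp only [blockCoeff, Finset.prod_mul_distrib, Finset.prod_const, Finset.card_univ, Fintype.card_fin,
        inv_pow]
      ring
    · rfl
  · intro b _ hb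
    refine Finset.sum_eq_zero fun a _ => ?_
    rw [pathCoeff_pair, if_neg (Ne.symm hb), ite_self]
  · intro h; exact absurd (Finset.mem_univ _) h

end PathSum

/-! ### §4 The Fourier side: Walsh coefficients of `(−1)^g`, the level-1 sum, the generating value -/

/-- The number of marked sites of `t` (the weight `|t|` of the `Z`-set). [folklore] -/
def wt (t : Fin m → Bool) : ℕ := (Finset.univ.filter fun j => t j = true).card

/-- The Walsh character `χ_t(c) = ∏_{j ∈ t} (−1)^{c_j}`. [cite: ODonnell2014, §1.2 (the characters χ_S)] -/
def chi (t c : Fin m → Bool) : ℝ := ∏ j, if t j then sgn (c j) else 1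

/-- The **Fourier–Walsh coefficient** `ĝ(t) = 2^{−m} Σ_c (−1)^{g(c)} χ_t(c)` of the `±1`-valued gate `(−1)^g` (for MAJ₃: `1/2` on singletons, `−1/2` on the triple — GGCT's "`F_2 = 3/2`, `F_4 = −1/2`" per block). [cite: ODonnell2014, §1.2 (Fourier expansion, f̂(S) = E[f χ_S])] [cite: GonzalezGarciaCiracTrivedi2025PauliPathBeyondAverageQuantum, Lemma 5 (V†Z_1V = (Z_1+Z_2+Z_3)/2 − Z_1Z_2Z_3/2)] -/
def ghat (g : (Fin m → Bool) → Bool) (t : Fin m → Bool) : ℝ :=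
  ((2 : ℝ) ^ m)⁻¹ * ∑ c : Fin m → Bool, sgn (g c) * chi t c

/-- The **level-1 Fourier sum** `W₁(g) = Σ_i ĝ({i}) = 2^{−m} Σ_c (−1)^{g(c)} Σ_i (−1)^{c_i}` — the LEVER (the total influence when `g` is monotone; `3/2` for MAJ₃). [cite: ODonnell2014, Prop 2.31 and eq. (2.3) (Σ_i f̂(i) = E[f(x)(x_1+⋯+x_n)])] -/
def levelOne (g : (Fin m → Bool) → Bool) : ℝ :=
  ((2 : ℝ) ^ m)⁻¹ * ∑ c : Fin m → Bool, sgn (g c) * ∑ i, sgn (c i)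

/-- The **block generating value** `A_g(x) = x Σ_t ĝ(t) x^{|t|} = x·2^{−m} Σ_c (−1)^{g(c)} ∏_j (1 + x(−1)^{c_j})` (`(3/2)x³·x⁻¹… = (3/2)x² − x⁴/2` times … for MAJ₃: `A(x) = (3x² − x⁴)/2`). [cite: GonzalezGarciaCiracTrivedi2025PauliPathBeyondAverageQuantum, Lemma 6 (ii) (E^{(ℓ)} = (3(1−p)²/2 − (1−p)⁴/2)^k for ℓ < 2k)] -/
def blockGen (g : (Fin m → Bool) → Bool) (x : ℝ) : ℝ :=
  x * (((2 : ℝ) ^ m)⁻¹ * ∑ c : Fin m → Bool, sgn (g c) * ∏ j, (1 + x * sgn (c j)))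

/-- Complementing the input multiplies `χ_t` by `(−1)^{|t|}`. [cite: ODonnell2014, §1.2 (χ_S(−x) = (−1)^{|S|} χ_S(x))] -/
theorem chi_not (t c : Fin m → Bool) : chi t (fun j => !c j) = (-1) ^ wt t * chi t c := by
  unfold chi wt
  have h : ∀ j, (if t j then sgn (!c j) else (1 : ℝ)) =
      (if t j = true then (-1 : ℝ) else 1) * (if t j then sgn (c j) else 1) := fun j => by
    by_cases ht : t j = true <;> simp [ht, sgn_not]
  simp only [h, Finset.prod_mul_distrib]; congr 1; rw [← Finset.prod_filter, Finset.prod_const]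

/-- **Odd gates have no even-level Fourier weight**: `ĝ(t) = 0` whenever `|t|` is even (so per block only the odd weights `1, 3, 5, …` carry path coefficients: "`F_1 = F_3 = 0`" in GGCT's path-weight count `|t|+1`). [cite: ODonnell2014, §1.2 (odd functions have only odd-degree Fourier coefficients)] [cite: GonzalezGarciaCiracTrivedi2025PauliPathBeyondAverageQuantum, Lemma 5 (F_1 = F_3 = 0)] -/
theorem ghat_eq_zero_of_even {g : (Fin m → Bool) → Bool} (hg : ∀ c : Fin m → Bool, g (fun j => !c j) = !g c) {t : Fin m → Bool}
    (ht : Even (wt t)) : ghat g t = 0 := by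
  have hsum : ∑ c : Fin m → Bool, sgn (g c) * chi t c = -∑ c : Fin m → Bool, sgn (g c) * chi t c := by
    conv_lhs => rw [← Equiv.sum_comp (⟨fun c j => !c j, fun c j => !c j, fun c => by funext j; simp,
      fun c => by funext j; simp⟩ : (Fin m → Bool) ≃ (Fin m → Bool))]
    rw [← Finset.sum_neg_distrib]
    refine Finset.sum_congr rfl fun c _ => ?_
    simp only [Equiv.coe_fn_mk]; rw [hg c, sgn_not, chi_not, Even.neg_one_pow ht]; ring
  have h0 : ∑ c : Fin m → Bool, sgn (g c) * chi t c = 0 := by linarith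
  rw [ghat, h0, mul_zero]

/-- The indicator `Z`-set `{i}`. [folklore] -/
def single (i : Fin m) : Fin m → Bool := fun j => decide (j = i)

/-- `|{i}| = 1`. [folklore] -/
private theorem wt_single (i : Fin m) : wt (single i) = 1 := by
  rw [wt, Finset.card_eq_one]
  exact ⟨i, by ext j; simp [single]⟩

/-- `χ_{{i}}(c) = (−1)^{c_i}`. [cite: ODonnell2014, §1.2 (χ_{{i}} = x_i)] -/
theorem chi_single (i : Fin m) (c : Fin m → Bool) : chi (single i) c = sgn (c i) := by
  unfold chi single; simp [Finset.prod_ite_eq']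

/-- `single` is injective. [folklore] -/
private theorem single_injective : Function.Injective (single (m := m)) := fun a b h => by
  simpa [single] using congrFun h a

/-- The `Z`-sets of weight one are exactly the singletons. [folklore] -/
private theorem filter_wt_eq_one : (Finset.univ.filter fun t : Fin m → Bool => wt t = 1) = Finset.univ.image single := by
  ext t
  simp only [Finset.mem_filter, Finset.mem_univ, true_and, Finset.mem_image]
  refine ⟨fun h => ?_, by rintro ⟨a, rfl⟩; exact wt_single a⟩
  obtain ⟨a, ha⟩ := Finset.card_eq_one.1 h
  refine ⟨a, funext fun j => ?_⟩
  have hj : (t j = true) ↔ j = a := by simpa using Finset.ext_iff.1 ha j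
  by_cases hja : j = a
  · rw [hj.2 hja]; simp [single, hja]
  · rw [show t j = false by simpa using (show ¬ (t j = true) from fun h' => hja (hj.1 h'))]; simp [single, hja]

/-- **The weight-one coefficients sum to the lever**: `Σ_{|t| = 1} ĝ(t) = W₁(g)`. [cite: ODonnell2014, eq. (2.3) (Σ_i f̂(i) = E[f(x)(x_1 + ⋯ + x_n)])] -/
theorem sum_ghat_wt_one (g : (Fin m → Bool) → Bool) :
    ∑ t : Fin m → Bool, (if wt t = 1 then ghat g t else 0) = levelOne g := by
  rw [← Finset.sum_filter, filter_wt_eq_one, Finset.sum_image fun a _ b _ h => single_injective h]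
  unfold ghat levelOne
  rw [← Finset.mul_sum, Finset.sum_comm]
  congr 1
  refine Finset.sum_congr rfl fun c _ => ?_
  rw [Finset.mul_sum]
  refine Finset.sum_congr rfl fun i _ => ?_
  rw [chi_single]

/-- **The full coefficient sum is the generating value**: `Σ_t x^{|t|+1} ĝ(t) = A_g(x)` (binomial expansion `Σ_t x^{|t|} χ_t(c) = ∏_j (1 + x(−1)^{c_j})`). [cite: ODonnell2014, §1.4 (T_ρ f = Σ_S ρ^{|S|} f̂(S) χ_S)] -/
theorem sum_ghat_pow (g : (Fin m → Bool) → Bool) (x : ℝ) :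
    ∑ t : Fin m → Bool, x ^ (wt t + 1) * ghat g t = blockGen g x := by
  unfold ghat blockGen
  have step1 : ∀ t : Fin m → Bool, x ^ (wt t + 1) * (((2 : ℝ) ^ m)⁻¹ * ∑ c, sgn (g c) * chi t c) =
      x * ((2 : ℝ) ^ m)⁻¹ * ∑ c, sgn (g c) * (x ^ wt t * chi t c) := by
    intro t; rw [pow_succ, Finset.mul_sum, Finset.mul_sum, Finset.mul_sum]
    exact Finset.sum_congr rfl fun c _ => by ring
  simp only [step1]
  rw [← Finset.mul_sum, Finset.sum_comm, mul_assoc]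
  congr 2
  refine Finset.sum_congr rfl fun c _ => ?_
  rw [← Finset.mul_sum]; congr 1
  -- `Σ_t x^{|t|} χ_t(c) = ∏_j (1 + x(−1)^{c_j})`
  have hpt : ∀ t : Fin m → Bool, x ^ wt t * chi t c = ∏ j, (if t j then x * sgn (c j) else 1) := by
    intro t; unfold chi wt
    rw [← Finset.prod_const, Finset.prod_filter, ← Finset.prod_mul_distrib]
    refine Finset.prod_congr rfl fun j _ => ?_
    by_cases h : t j = true <;> simp [h]
  simp only [hpt]
  rw [← Fintype.prod_sum fun j (b : Bool) => if b then x * sgn (c j) else 1]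
  exact Finset.prod_congr rfl fun j _ => by simp [add_comm]

/-- **The generating value is a damped average**: `|A_g(x)| ≤ x` on `[0,1]` (the noisy expectation of a `±1` observable never exceeds one; `Σ_c ∏_j (1 + x(−1)^{c_j}) = 2^m`). [cite: GonzalezGarciaCiracTrivedi2025PauliPathBeyondAverageQuantum, Lemma 6 (ii) ("(1−p)^{Ω(ℓ)}": the exact value stays bounded)] -/
theorem abs_blockGen_le (g : (Fin m → Bool) → Bool) {x : ℝ} (hx0 : 0 ≤ x) (hx1 : x ≤ 1) :
    |blockGen g x| ≤ x := by
  have hfac : ∀ (c : Fin m → Bool) j, 0 ≤ 1 + x * sgn (c j) := fun c j => by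
    unfold sgn; split_ifs <;> nlinarith
  have htot : ∑ c : Fin m → Bool, ∏ j, (1 + x * sgn (c j)) = (2 : ℝ) ^ m := by
    rw [← Fintype.prod_sum fun (_ : Fin m) (b : Bool) => 1 + x * sgn b]
    simp [sgn, Finset.prod_const]; ring
  have hsum : |∑ c : Fin m → Bool, sgn (g c) * ∏ j, (1 + x * sgn (c j))| ≤ (2 : ℝ) ^ m := by
    refine (Finset.abs_sum_le_sum_abs _ _).trans (htot ▸ Finset.sum_le_sum fun c _ => ?_)
    rw [abs_mul, abs_sgn, one_mul, abs_of_nonneg (Finset.prod_nonneg fun j _ => hfac c j)]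
  have h2 : (0 : ℝ) < (2 : ℝ) ^ m := pow_pos (by norm_num) m
  rw [blockGen, abs_mul, abs_of_nonneg hx0, abs_mul, abs_of_nonneg (inv_nonneg.2 h2.le)]
  calc x * (((2 : ℝ) ^ m)⁻¹ * |∑ c : Fin m → Bool, sgn (g c) * ∏ j, (1 + x * sgn (c j))|)
      ≤ x * (((2 : ℝ) ^ m)⁻¹ * (2 : ℝ) ^ m) := by gcongr
    _ = x := by rw [inv_mul_cancel₀ h2.ne', mul_one]

/-! ### §5 The bridge: block weights are Walsh coefficients; the path sum in `Z`-set language -/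

section Bridge

variable {g : (Fin m → Bool) → Bool} (hg : ∀ c : Fin m → Bool, g (fun j => !c j) = !g c) (i₀ : Fin m)

/-- The `Z`-type string with `Z` exactly at the marked sites. [folklore] -/
def bits (t : Fin m → Bool) : Fin m → Pauli := fun j => if t j then Pauli.Z else Pauli.I

/-- `bits t` is a `Z`-type string. [folklore] -/
private theorem bits_IZ (t : Fin m → Bool) (j : Fin m) : bits t j = Pauli.I ∨ bits t j = Pauli.Z := by unfold bits; split_ifs <;> simp

/-- Diagonal entries of `bits t`: the character `χ_t(c)`. [folklore] -/
private theorem pauliString_bits_apply (t c : Fin m → Bool) :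
    pauliString (bits t) c c = ((chi t c : ℝ) : ℂ) := by
  rw [pauliString_apply_of_IZ _ (bits_IZ t), if_pos rfl, chi, Complex.ofReal_prod]
  exact Finset.prod_congr rfl fun j _ => by by_cases h : t j = true <;> simp [bits, h, sgn_cast]

/-- The weight of `bits t` is the number of marked sites. [folklore] -/
private theorem strWeight_bits (t : Fin m → Bool) : strWeight (bits t) = wt t := by
  rw [strWeight_eq, wt]; congr 1; ext j; simp [bits]

/-- `{I,Z}`-strings are exactly the `bits t`. [folklore] -/
private theorem eq_bits_of_IZ {b : Fin m → Pauli} (h : ∀ j, b j = Pauli.I ∨ b j = Pauli.Z) :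
    b = bits fun j => decide (b j = Pauli.Z) := by
  funext j; rcases h j with hj | hj <;> simp [bits, hj]

/-- `bits` is injective. [folklore] -/
private theorem bits_injective : Function.Injective (bits (m := m)) := fun t t' h => by
  funext j; have := congrFun h j; cases ht : t j <;> cases ht' : t' j <;> simp_all [bits]

include hg in
/-- **The block weight of a `Z`-set is its Walsh coefficient**: `τ_g(Z^t) = ĝ(t)`. [cite: GonzalezGarciaCiracTrivedi2025PauliPathBeyondAverageQuantum, Lemma 5 (the coefficients 1/2, 1/2, 1/2, −1/2 of V†Z_1V)] -/
theorem blockCoeff_bits (t : Fin m → Bool) : blockCoeff g i₀ (bits t) = ((ghat g t : ℝ) : ℂ) := by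
  rw [blockCoeff, blockAmp_eq hg, pauliString_zero_zero, if_pos (bits_IZ t), mul_one, ghat]
  push_cast
  exact congrArg _ (Finset.sum_congr rfl fun c _ => by rw [pauliString_bits_apply])

/-- The **`Z`-set path sum** `S_k(P) = Σ_{τ : k Z-sets} [P(Σᵢ(|τᵢ|+1))] ∏ᵢ x^{|τᵢ|+1} ĝ(τᵢ)` — the witness's filtered path sum with the matrices gone. [cite: GonzalezGarciaCiracTrivedi2025PauliPathBeyondAverageQuantum, Lemma 6 (E^{(ℓ)}_{𝒞_k} = Σ_{w>ℓ} F_w(𝒞_k)(1−p)^w)] -/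
def tSum (g : (Fin m → Bool) → Bool) (x : ℂ) (k : ℕ) (P : ℕ → Prop) [DecidablePred P] : ℂ :=
  ∑ τ : Fin k → Fin m → Bool, if P (∑ i, (wt (τ i) + 1)) then
    ∏ i, (x ^ (wt (τ i) + 1) * ((ghat g (τ i) : ℝ) : ℂ)) else 0

include hg in
/-- **Bridge**: the block-indexed sum over Pauli strings equals the `Z`-set path sum. [cite: GonzalezGarciaCiracTrivedi2025PauliPathBeyondAverageQuantum, Lemma 5 (proof: only Z-type block strings contribute)] -/
theorem blocks_eq_tSum (x : ℂ) (k : ℕ) (P : ℕ → Prop) [DecidablePred P] :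
    (∑ β : Fin k → Fin m → Pauli, if P (∑ i, (strWeight (β i) + 1)) then
        ∏ i, (x ^ (strWeight (β i) + 1) * blockCoeff g i₀ (β i)) else 0) = tSum g x k P := by
  have hinj : Function.Injective fun (τ : Fin k → Fin m → Bool) (i : Fin k) => bits (τ i) :=
    fun τ τ' h => funext fun i => bits_injective (congrFun h i)
  rw [← Finset.sum_subset (Finset.subset_univ (Finset.univ.image fun (τ : Fin k → Fin m → Bool) i => bits (τ i)))]
  · rw [Finset.sum_image fun τ _ τ' _ h => hinj h, tSum]
    refine Finset.sum_congr rfl fun τ _ => ?_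
    simp only [strWeight_bits, blockCoeff_bits hg]
  · intro β _ hβ
    have hex : ∃ i, ¬ ∀ j, β i j = Pauli.I ∨ β i j = Pauli.Z := by
      by_contra hc; push Not at hc
      exact hβ (Finset.mem_image.2 ⟨fun i j => decide (β i j = Pauli.Z), Finset.mem_univ _,
        funext fun i => (eq_bits_of_IZ (hc i)).symm⟩)
    obtain ⟨i, hi⟩ := hex
    have h0 : ∏ i, (x ^ (strWeight (β i) + 1) * blockCoeff g i₀ (β i)) = 0 :=
      Finset.prod_eq_zero (Finset.mem_univ i) (by rw [blockCoeff, pauliString_zero_zero, if_neg hi, mul_zero, mul_zero])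
    rw [h0, ite_self]

include hg in
/-- **The filtered path sum of the witness is the `Z`-set path sum at `x = 1 − p`.** [cite: GonzalezGarciaCiracTrivedi2025PauliPathBeyondAverageQuantum, Lemma 6 (E^{(ℓ)} as a sum over block weights)] -/
theorem filter_sum_pathCoeff_eq_tSum (p : ℂ) (k : ℕ) (P : ℕ → Prop) [DecidablePred P] :
    ∑ s ∈ Finset.univ.filter (fun s : Fin (1 + 1) → Fin k × Fin m → Pauli => P (pathWeight s)),
        pathCoeff p (wideLayers g i₀ k) (wideInput m k) (pauliString (wideObs i₀ k)) s = tSum g (1 - p) k P := by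
  rw [filter_sum_pathCoeff_eq, blocks_eq_tSum hg]

end Bridge

/-! ### §6 The recursion over blocks and its two evaluations -/

section Recursion

variable {g : (Fin m → Bool) → Bool} (hg : ∀ c : Fin m → Bool, g (fun j => !c j) = !g c)

/-- Sums over `(L+1)`-tuples split into the last entry and the initial `L`-tuple. [folklore] -/
private theorem sum_snoc' {α M : Type*} [Fintype α] [AddCommMonoid M] {L : ℕ} (G : (Fin (L + 1) → α) → M) :
    ∑ φ, G φ = ∑ a : α, ∑ φ' : Fin L → α, G (Fin.snoc φ' a) := by
  rw [← (Fin.snocEquiv fun _ => α).sum_comp, Fintype.sum_prod_type]; rfl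

/-- No blocks: `S_0(P) = [P 0]`. [folklore] -/
private theorem tSum_zero (g : (Fin m → Bool) → Bool) (x : ℂ) (P : ℕ → Prop) [DecidablePred P] :
    tSum g x 0 P = if P 0 then 1 else 0 := by simp [tSum]

/-- **Peeling one block**: `S_{k+1}(P) = Σ_t x^{|t|+1} ĝ(t) · S_k(P(· + |t| + 1))`. [cite: GonzalezGarciaCiracTrivedi2025PauliPathBeyondAverageQuantum, Lemma 6 (proof: F_w(𝒞_k) block by block)] -/
theorem tSum_succ (g : (Fin m → Bool) → Bool) (x : ℂ) (k : ℕ) (P : ℕ → Prop) [DecidablePred P] :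
    tSum g x (k + 1) P = ∑ t : Fin m → Bool, x ^ (wt t + 1) * ((ghat g t : ℝ) : ℂ) *
      tSum g x k (fun w => P (w + (wt t + 1))) := by
  rw [tSum, sum_snoc']
  refine Finset.sum_congr rfl fun t _ => ?_
  rw [tSum, Finset.mul_sum]
  refine Finset.sum_congr rfl fun τ _ => ?_
  simp only [Fin.sum_univ_castSucc, Fin.prod_univ_castSucc, Fin.snoc_castSucc, Fin.snoc_last]
  split_ifs <;> ring

/-- `S_k` depends on the predicate only through its truth values. [folklore] -/
private theorem tSum_congr (g : (Fin m → Bool) → Bool) (x : ℂ) (k : ℕ) {P Q : ℕ → Prop} [DecidablePred P]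
    [DecidablePred Q] (h : ∀ w, P w ↔ Q w) : tSum g x k P = tSum g x k Q :=
  Finset.sum_congr rfl fun τ _ => by simp only [h]

/-- **All blocks at once**: `S_k(⊤) = A_g(x)^k`. [cite: GonzalezGarciaCiracTrivedi2025PauliPathBeyondAverageQuantum, Lemma 6 (ii) (the exact value (3(1−p)²/2 − (1−p)⁴/2)^k)] -/
theorem tSum_true (g : (Fin m → Bool) → Bool) (x : ℝ) (k : ℕ) :
    tSum g (x : ℂ) k (fun _ => True) = (((blockGen g x) ^ k : ℝ) : ℂ) := by
  rw [tSum]; simp only [if_true]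
  rw [← Fintype.prod_sum fun (_ : Fin k) (t : Fin m → Bool) => (x : ℂ) ^ (wt t + 1) * ((ghat g t : ℝ) : ℂ),
    Finset.prod_const, Finset.card_univ, Fintype.card_fin, ← sum_ghat_pow]
  push_cast; rfl

include hg in
/-- **Vanishing below the diagonal**: if `P` fails at every weight `≥ 2k` then `S_k(P) = 0` (every contributing block has odd `|t| ≥ 1`, i.e. path weight `≥ 2`: "for `w < 2k` it is `F_w(𝒞_k) = 0`"). [cite: GonzalezGarciaCiracTrivedi2025PauliPathBeyondAverageQuantum, Lemma 6 (i)] -/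
theorem tSum_eq_zero_of_high (x : ℂ) : ∀ (k : ℕ) (P : ℕ → Prop) [DecidablePred P],
    (∀ w, 2 * k ≤ w → ¬ P w) → tSum g x k P = 0 := by
  intro k; induction k with
  | zero => intro P _ hP; rw [tSum_zero, if_neg (hP 0 (le_refl _))]
  | succ k ih =>
    intro P _ hP
    rw [tSum_succ]
    refine Finset.sum_eq_zero fun t _ => ?_
    by_cases he : Even (wt t)
    · rw [ghat_eq_zero_of_even hg he]; simp
    · have h1 : 1 ≤ wt t := ((Nat.not_even_iff_odd.1 he)).pos
      rw [ih (fun w => P (w + (wt t + 1))) (fun w hw => hP _ (by omega)), mul_zero]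

include hg in
/-- **The window evaluation**: for `2k ≤ ℓ ≤ 2k+1`, `S_k(· ≤ ℓ) = (W₁(g) x²)^k` — only the all-singleton block patterns (path weight exactly `2k`) survive the cut-off ("`F_{2k} = (3/2)^k`"). [cite: GonzalezGarciaCiracTrivedi2025PauliPathBeyondAverageQuantum, Lemma 5 (F_{2k} = (3/2)^k) and Lemma 6 (i)] -/
theorem tSum_window (x : ℝ) : ∀ (k ℓ : ℕ), 2 * k ≤ ℓ → ℓ ≤ 2 * k + 1 →
    tSum g (x : ℂ) k (· ≤ ℓ) = (((levelOne g * x ^ 2) ^ k : ℝ) : ℂ) := by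
  intro k; induction k with
  | zero => intro ℓ _ _; rw [tSum_zero, if_pos (Nat.zero_le _)]; simp
  | succ k ih =>
    intro ℓ h1 h2
    rw [tSum_succ]
    have hterm : ∀ t : Fin m → Bool, (x : ℂ) ^ (wt t + 1) * ((ghat g t : ℝ) : ℂ) *
        tSum g (x : ℂ) k (fun w => w + (wt t + 1) ≤ ℓ) =
          if wt t = 1 then (x : ℂ) ^ 2 * (((levelOne g * x ^ 2) ^ k : ℝ) : ℂ) * ((ghat g t : ℝ) : ℂ) else 0 := by
      intro t
      by_cases hw : wt t = 1
      · rw [if_pos hw, hw, tSum_congr g (x : ℂ) k (Q := (· ≤ ℓ - 2)) (fun w => by omega),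
          ih (ℓ - 2) (by omega) (by omega)]
        ring
      · rw [if_neg hw]
        by_cases he : Even (wt t)
        · rw [ghat_eq_zero_of_even hg he]; simp
        · have h3 : 3 ≤ wt t := by obtain ⟨r, hr⟩ := Nat.not_even_iff_odd.1 he; omega
          rw [tSum_eq_zero_of_high hg (x : ℂ) k _ (fun w hw => by omega), mul_zero]
    simp only [hterm]
    rw [← Finset.sum_filter, ← Finset.mul_sum, Finset.sum_filter]
    have hcast : ∑ t : Fin m → Bool, (if wt t = 1 then ((ghat g t : ℝ) : ℂ) else 0) = ((levelOne g : ℝ) : ℂ) := by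
      rw [← sum_ghat_wt_one, Complex.ofReal_sum]
      refine Finset.sum_congr rfl fun t _ => ?_
      split_ifs <;> simp
    rw [hcast]; push_cast; ring

end Recursion

/-! ### §7 The witness in closed form and the threshold-free truncation floor -/

section Floor

variable {g : (Fin m → Bool) → Bool} (hg : ∀ c : Fin m → Bool, g (fun j => !c j) = !g c) (i₀ : Fin m)

include hg in
/-- **The noisy value in closed form**: `⟨O_k⟩_err = A_g(1−p)^k`. [cite: GonzalezGarciaCiracTrivedi2025PauliPathBeyondAverageQuantum, Lemma 6 (ii) and §3 (⟨O⟩_err = Σ_s f(s)(1−p)^{|s|})] -/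
theorem noisyValue_eq (p : ℝ) (k : ℕ) :
    noisyValue (p : ℂ) (wideLayers g i₀ k) (wideInput m k) (pauliString (wideObs i₀ k)) =
      (((blockGen g (1 - p)) ^ k : ℝ) : ℂ) := by
  rw [noisyValue_eq_sum_pathCoeff, ← Finset.filter_true_of_mem (s := Finset.univ)
    (p := fun s : Fin (1 + 1) → Fin k × Fin m → Pauli => (fun _ => True) (pathWeight s)) fun _ _ => trivial,
    filter_sum_pathCoeff_eq_tSum hg i₀ (p : ℂ) k (fun _ => True),
    show (1 : ℂ) - (p : ℂ) = ((1 - p : ℝ) : ℂ) by push_cast; ring, tSum_true]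

include hg in
/-- **Below the diagonal the truncation sees nothing**: `⟨O_k⟩_ℓ = 0` for `ℓ < 2k`. [cite: GonzalezGarciaCiracTrivedi2025PauliPathBeyondAverageQuantum, Lemma 6 (i)–(ii)] -/
theorem truncValue_eq_zero (p : ℝ) (k ℓ : ℕ) (h : ℓ < 2 * k) :
    truncValue (p : ℂ) ℓ (wideLayers g i₀ k) (wideInput m k) (pauliString (wideObs i₀ k)) = 0 := by
  rw [truncValue, filter_sum_pathCoeff_eq_tSum hg i₀ (p : ℂ) k (· ≤ ℓ)]
  exact tSum_eq_zero_of_high hg _ k _ fun w hw => by omega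

include hg in
/-- **The window in closed form**: `⟨O_k⟩_ℓ = (W₁(g)(1−p)²)^k` for `2k ≤ ℓ ≤ 2k+1` (every cut-off `ℓ` is met by `k = ⌊ℓ/2⌋` blocks). [cite: GonzalezGarciaCiracTrivedi2025PauliPathBeyondAverageQuantum, Lemma 5 (F_{2k} = (3/2)^k)] -/
theorem truncValue_eq (p : ℝ) (k ℓ : ℕ) (h1 : 2 * k ≤ ℓ) (h2 : ℓ ≤ 2 * k + 1) :
    truncValue (p : ℂ) ℓ (wideLayers g i₀ k) (wideInput m k) (pauliString (wideObs i₀ k)) =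
      (((levelOne g * (1 - p) ^ 2) ^ k : ℝ) : ℂ) := by
  rw [truncValue, filter_sum_pathCoeff_eq_tSum hg i₀ (p : ℂ) k (· ≤ ℓ),
    show (1 : ℂ) - (p : ℂ) = ((1 - p : ℝ) : ℂ) by push_cast; ring]
  exact tSum_window hg (1 - p) k ℓ h1 h2

include hg in
/-- **THE TRUNCATION FLOOR (threshold-free)**: for every rate `0 ≤ p ≤ 1`, every `k` and every cut-off `2k ≤ ℓ ≤ 2k+1`, `‖⟨O_k⟩_err − ⟨O_k⟩_ℓ‖ ≥ (W₁(g)(1−p)²)^k − (1−p)^k`; it grows geometrically in `k` as soon as `W₁(g)(1−p)² > 1`. [cite: GonzalezGarciaCiracTrivedi2025PauliPathBeyondAverageQuantum, Lemma 6 (v) (|E^{(ℓ)}| ≥ ((3/2)(1−p)²)^k − 1)] -/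
theorem truncation_floor (p : ℝ) (hp0 : 0 ≤ p) (hp1 : p ≤ 1) (k ℓ : ℕ) (h1 : 2 * k ≤ ℓ) (h2 : ℓ ≤ 2 * k + 1) :
    (levelOne g * (1 - p) ^ 2) ^ k - (1 - p) ^ k ≤
      ‖noisyValue (p : ℂ) (wideLayers g i₀ k) (wideInput m k) (pauliString (wideObs i₀ k)) -
          truncValue (p : ℂ) ℓ (wideLayers g i₀ k) (wideInput m k) (pauliString (wideObs i₀ k))‖ := by
  rw [noisyValue_eq hg, truncValue_eq hg i₀ p k ℓ h1 h2, ← Complex.ofReal_sub, Complex.norm_real,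
    Real.norm_eq_abs]
  have hA : |blockGen g (1 - p) ^ k| ≤ (1 - p) ^ k := by
    rw [abs_pow]
    exact pow_le_pow_left₀ (abs_nonneg _) (abs_blockGen_le g (by linarith) (by linarith)) k
  have hB : (levelOne g * (1 - p) ^ 2) ^ k ≤ |(levelOne g * (1 - p) ^ 2) ^ k| := le_abs_self _
  have htri := abs_sub_abs_le_abs_sub ((levelOne g * (1 - p) ^ 2) ^ k) (blockGen g (1 - p) ^ k)
  rw [abs_sub_comm] at htri
  linarith

include hg in
/-- The floor in GGCT's printed shape: `‖⟨O_k⟩_err − ⟨O_k⟩_ℓ‖ ≥ (W₁(g)(1−p)²)^k − 1`. [cite: GonzalezGarciaCiracTrivedi2025PauliPathBeyondAverageQuantum, Lemma 6 (v)] -/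
theorem truncation_floor_sub_one (p : ℝ) (hp0 : 0 ≤ p) (hp1 : p ≤ 1) (k ℓ : ℕ) (h1 : 2 * k ≤ ℓ)
    (h2 : ℓ ≤ 2 * k + 1) :
    (levelOne g * (1 - p) ^ 2) ^ k - 1 ≤
      ‖noisyValue (p : ℂ) (wideLayers g i₀ k) (wideInput m k) (pauliString (wideObs i₀ k)) -
          truncValue (p : ℂ) ℓ (wideLayers g i₀ k) (wideInput m k) (pauliString (wideObs i₀ k))‖ := by
  have h := truncation_floor hg i₀ p hp0 hp1 k ℓ h1 h2
  have hx : (1 - p) ^ k ≤ 1 := pow_le_one₀ (by linarith) (by linarith)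
  linarith

end Floor

/-! ### §8 The majority family: extremality of the lever, closed form, growth, numbers -/

/-- **Majority on `m` bits** (strict: more `true`s than `false`s; odd `m` is the case of interest). [cite: ODonnell2014, §2.1 (Maj_n, n odd)] -/
def maj (m : ℕ) (c : Fin m → Bool) : Bool := decide (m < 2 * wt c)

/-- Complementing the input complements the count: `|¬c| + |c| = m`. [folklore] -/
private theorem wt_not_add (c : Fin m → Bool) : wt (fun j => !c j) + wt c = m := by
  unfold wt
  have h : (Finset.univ.filter fun j => (!c j) = true) = Finset.univ.filter fun j => ¬ (c j = true) := by
    ext j; simp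
  rw [h, add_comm, Finset.card_filter_add_card_filter_not, Finset.card_univ, Fintype.card_fin]

/-- **Majority on an odd number of bits is an odd gate.** [cite: ODonnell2014, §2.1 (Maj_n is odd)] -/
theorem maj_odd (hm : Odd m) (c : Fin m → Bool) : maj m (fun j => !c j) = !maj m c := by
  obtain ⟨r, hr⟩ := hm; have h := wt_not_add c; unfold maj
  by_cases hc : m < 2 * wt c
  · rw [decide_eq_true hc, Bool.not_true, decide_eq_false]; omega
  · rw [decide_eq_false hc, Bool.not_false, decide_eq_true]; omega

/-- `Σ_i (−1)^{c_i} = m − 2|c|`. [folklore] -/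
private theorem sum_sgn_eq (c : Fin m → Bool) : ∑ i, sgn (c i) = (m : ℝ) - 2 * (wt c : ℝ) := by
  have h : ∀ i, sgn (c i) = 1 - 2 * (if c i = true then (1 : ℝ) else 0) := by
    intro i; unfold sgn; split_ifs <;> norm_num
  simp only [h, Finset.sum_sub_distrib, Finset.sum_const, Finset.card_univ, Fintype.card_fin, nsmul_eq_mul,
    mul_one, ← Finset.mul_sum, Finset.sum_boole, wt]

/-- `(−1)^{Maj(c)}·(m − 2|c|) = |m − 2|c||`: majority picks the sign of the bias. [cite: ODonnell2014, Thm 2.33 (proof: Maj_n(x) = sgn(x_1 + ⋯ + x_n))] -/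
theorem sgn_maj_mul (c : Fin m → Bool) : sgn (maj m c) * ((m : ℝ) - 2 * wt c) = |(m : ℝ) - 2 * wt c| := by
  unfold maj sgn
  by_cases h : m < 2 * wt c
  · have h' : (m : ℝ) < 2 * wt c := by exact_mod_cast h
    rw [decide_eq_true h, if_pos rfl, abs_of_neg (by linarith)]; ring
  · have h' : (2 : ℝ) * wt c ≤ m := by exact_mod_cast (not_lt.1 h)
    rw [decide_eq_false h, abs_of_nonneg (by linarith)]; simp

/-- **EXTREMALITY OF THE LEVER (T4)**: `W₁(g) ≤ W₁(Maj_m)` for EVERY Boolean gate `g` on `m` bits — the finite inequality `E[f·(x_1+⋯+x_m)] ≤ E|x_1+⋯+x_m|`, with equality at majority. [cite: ODonnell2014, Thm 2.33 p. 44 (Σ_i f̂(i) ≤ Σ_i \widehat{Maj_n}(i), re-proved here as the finite inequality)] -/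
theorem levelOne_le_maj (g : (Fin m → Bool) → Bool) : levelOne g ≤ levelOne (maj m) := by
  unfold levelOne
  refine mul_le_mul_of_nonneg_left (Finset.sum_le_sum fun c _ => ?_) (inv_nonneg.2 (pow_nonneg (by norm_num) m))
  rw [sum_sgn_eq, sgn_maj_mul]
  calc sgn (g c) * ((m : ℝ) - 2 * wt c) ≤ |sgn (g c) * ((m : ℝ) - 2 * wt c)| := le_abs_self _
    _ = |(m : ℝ) - 2 * wt c| := by rw [abs_mul, abs_sgn, one_mul]

/-- The lever of majority as an absolute first moment: `W₁(Maj_m) = 2^{−m} Σ_c |m − 2|c||`. [cite: ODonnell2014, Thm 2.33 (Σ_i \widehat{Maj_n}(i) = E|x_1 + ⋯ + x_n|)] -/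
theorem levelOne_maj (m : ℕ) : levelOne (maj m) = ((2 : ℝ) ^ m)⁻¹ * ∑ c : Fin m → Bool, |(m : ℝ) - 2 * wt c| := by
  unfold levelOne; congr 1
  exact Finset.sum_congr rfl fun c _ => by rw [sum_sgn_eq, sgn_maj_mul]

/-- **Grouping by the count**: `Σ_c F(|c|) = Σ_{s=0}^{m} C(m,s) F(s)`. [folklore] -/
private theorem sum_by_wt (F : ℕ → ℝ) :
    ∑ c : Fin m → Bool, F (wt c) = ∑ s ∈ Finset.range (m + 1), (m.choose s : ℝ) * F s := by
  have h1 : ∑ c : Fin m → Bool, F (wt c) = ∑ T ∈ (Finset.univ : Finset (Fin m)).powerset, F T.card := by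
    refine Finset.sum_nbij' (fun c => Finset.univ.filter fun j => c j = true) (fun T j => decide (j ∈ T))
      ?_ ?_ ?_ ?_ ?_
    · intro c _; simp
    · intro T _; exact Finset.mem_univ _
    · intro c _; funext j; simp
    · intro T _; ext j; simp
    · intro c _; rfl
  rw [h1, Finset.sum_powerset_apply_card, Finset.card_univ, Fintype.card_fin]
  exact Finset.sum_congr rfl fun s _ => by rw [nsmul_eq_mul]

/-- The telescoping binomial sum `Σ_{j ≤ s} C(2r+1, j)(2r+1−2j) = (2r+1)·C(2r, s)`. [folklore] -/
private theorem choose_telescope (r : ℕ) : ∀ s : ℕ,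
    ∑ j ∈ Finset.range (s + 1), ((2 * r + 1).choose j : ℝ) * ((2 * r + 1 : ℝ) - 2 * j) =
      (2 * r + 1 : ℝ) * ((2 * r).choose s : ℝ) := by
  intro s; induction s with
  | zero => simp
  | succ s ih =>
    rw [Finset.sum_range_succ, ih]
    have ha : (2 * r + 1 : ℝ) * ((2 * r).choose s : ℝ) = (((2 * r + 1).choose (s + 1) : ℕ) : ℝ) * ((s : ℝ) + 1) := by
      exact_mod_cast Nat.add_one_mul_choose_eq (2 * r) s
    have hb : (((2 * r + 1).choose (s + 1) : ℕ) : ℝ) = ((2 * r).choose s : ℝ) + ((2 * r).choose (s + 1) : ℝ) := by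
      exact_mod_cast Nat.choose_succ_succ (2 * r) s
    push_cast
    linear_combination 2 * ha + (2 * r + 1 : ℝ) * hb

/-- The absolute first moment of the binomial: `Σ_{s} C(2r+1, s)|2r+1−2s| = 2(2r+1)·C(2r, r)`. [folklore] -/
private theorem sum_choose_abs (r : ℕ) :
    ∑ s ∈ Finset.range (2 * r + 1 + 1), ((2 * r + 1).choose s : ℝ) * |((2 * r + 1 : ℕ) : ℝ) - 2 * s| =
      2 * ((2 * r + 1 : ℝ) * ((2 * r).choose r : ℝ)) := by
  set F : ℕ → ℝ := fun s => ((2 * r + 1).choose s : ℝ) * |((2 * r + 1 : ℕ) : ℝ) - 2 * s| with hF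
  have hlow : ∀ s, s ≤ r → F s = ((2 * r + 1).choose s : ℝ) * ((2 * r + 1 : ℝ) - 2 * s) := by
    intro s hs; have : (s : ℝ) ≤ r := by exact_mod_cast hs
    simp only [hF]; push_cast; rw [abs_of_nonneg (by linarith)]
  have hsym : ∀ x, x ≤ r → F (r + 1 + x) = F (r - x) := by
    intro x hx; have hx0 : (0 : ℝ) ≤ x := Nat.cast_nonneg x; have hxr : (x : ℝ) ≤ r := by exact_mod_cast hx
    simp only [hF]
    rw [Nat.choose_symm_of_eq_add (a := r + 1 + x) (b := r - x) (by omega), Nat.cast_sub hx]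
    push_cast
    rw [abs_of_nonpos (by linarith), abs_of_nonneg (by linarith)]
    ring
  calc ∑ s ∈ Finset.range (2 * r + 1 + 1), F s
      = ∑ s ∈ Finset.range (r + 1), F s + ∑ x ∈ Finset.range (r + 1), F (r + 1 + x) := by
        rw [show 2 * r + 1 + 1 = (r + 1) + (r + 1) by ring, Finset.sum_range_add]
    _ = ∑ s ∈ Finset.range (r + 1), F s + ∑ x ∈ Finset.range (r + 1), F (r + 1 - 1 - x) := by
        congr 1
        refine Finset.sum_congr rfl fun x hx => ?_
        rw [Finset.mem_range] at hx
        rw [hsym x (by omega), show r + 1 - 1 - x = r - x by omega]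
    _ = 2 * ∑ s ∈ Finset.range (r + 1), F s := by rw [Finset.sum_range_reflect, two_mul]
    _ = 2 * ((2 * r + 1 : ℝ) * ((2 * r).choose r : ℝ)) := by
        rw [← choose_telescope r r]
        congr 1
        refine Finset.sum_congr rfl fun s hs => ?_
        rw [Finset.mem_range] at hs
        exact hlow s (by omega)

/-- **CLOSED FORM (T5)**: `W₁(Maj_{2r+1}) = (2r+1)·C(2r, r)/4^r` (`= 3/2, 15/8, 35/16, 315/128` for `m = 3, 5, 7, 9`). [cite: ODonnell2014, Ex. 2.22 / Prop 2.31 p. 43 (I[Maj_n] = n·C(n−1,(n−1)/2)/2^{n−1})] -/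
theorem levelOne_maj_eq (r : ℕ) :
    levelOne (maj (2 * r + 1)) = (2 * r + 1 : ℝ) * ((2 * r).choose r : ℝ) / 4 ^ r := by
  rw [levelOne_maj, sum_by_wt (F := fun s => |((2 * r + 1 : ℕ) : ℝ) - 2 * (s : ℝ)|), sum_choose_abs,
    pow_succ, pow_mul]
  norm_num; field_simp

/-- The central binomial bound `16^r ≤ 4r·C(2r, r)²` (`r ≥ 1`), i.e. `C(2r,r)/4^r ≥ 1/(2√r)`. [folklore] -/
private theorem sixteen_pow_le (r : ℕ) (hr : 1 ≤ r) : (16 : ℝ) ^ r ≤ 4 * r * ((2 * r).choose r : ℝ) ^ 2 := by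
  induction r, hr using Nat.le_induction with
  | base => norm_num [Nat.choose]
  | succ r hr ih =>
    have hrec : ((r : ℝ) + 1) * ((2 * (r + 1)).choose (r + 1) : ℝ) = 2 * (2 * r + 1 : ℝ) * ((2 * r).choose r : ℝ) := by
      have h := Nat.succ_mul_centralBinom_succ r
      rw [Nat.centralBinom_eq_two_mul_choose, Nat.centralBinom_eq_two_mul_choose] at h
      exact_mod_cast h
    have hr1 : (1 : ℝ) ≤ r := by exact_mod_cast hr
    have key : (16 : ℝ) ^ r * (r + 1) ≤ (2 * r + 1) ^ 2 * ((2 * r).choose r : ℝ) ^ 2 := by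
      nlinarith [ih, sq_nonneg (((2 * r).choose r : ℕ) : ℝ)]
    have h2 : (16 : ℝ) ^ (r + 1) * (r + 1) ≤ 4 * ((r : ℝ) + 1) * ((2 * (r + 1)).choose (r + 1) : ℝ) ^ 2 * (r + 1) :=
      calc (16 : ℝ) ^ (r + 1) * (r + 1) = 16 * ((16 : ℝ) ^ r * (r + 1)) := by ring
        _ ≤ 16 * ((2 * r + 1) ^ 2 * ((2 * r).choose r : ℝ) ^ 2) := by linarith
        _ = 4 * (((r : ℝ) + 1) * ((2 * (r + 1)).choose (r + 1) : ℝ)) ^ 2 := by rw [hrec]; ring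
        _ = 4 * ((r : ℝ) + 1) * ((2 * (r + 1)).choose (r + 1) : ℝ) ^ 2 * (r + 1) := by ring
    push_cast
    exact le_of_mul_le_mul_right h2 (by positivity)

/-- **GROWTH (T5)**: `W₁(Maj_{2r+1})² ≥ r + 1` — the lever is unbounded along the odd widths. [cite: ODonnell2014, Ex. 2.22 (I[Maj_n] ~ √(2n/π))] -/
theorem levelOne_maj_sq_ge (r : ℕ) : (r + 1 : ℝ) ≤ levelOne (maj (2 * r + 1)) ^ 2 := by
  rw [levelOne_maj_eq]
  rcases Nat.eq_zero_or_pos r with h0 | hpos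
  · subst h0; norm_num [Nat.choose]
  · have hb := sixteen_pow_le r hpos
    have hr1 : (1 : ℝ) ≤ r := by exact_mod_cast hpos
    have h16 : ((4 : ℝ) ^ r) ^ 2 = 16 ^ r := by rw [sq, ← mul_pow]; norm_num
    rw [div_pow, h16, le_div_iff₀ (by positivity)]
    nlinarith [hb, sq_nonneg (((2 * r).choose r : ℕ) : ℝ)]

/-- **THE FOUR RATIONAL LEVERS (T6)**: `W₁(Maj_3) = 3/2`, `W₁(Maj_5) = 15/8`, `W₁(Maj_7) = 35/16`, `W₁(Maj_9) = 315/128`. [cite: ODonnell2014, Ex. 2.22 / Prop 2.31] -/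
theorem levelOne_maj_values :
    levelOne (maj 3) = 3 / 2 ∧ levelOne (maj 5) = 15 / 8 ∧ levelOne (maj 7) = 35 / 16 ∧
      levelOne (maj 9) = 315 / 128 := by
  have h1 := levelOne_maj_eq 1; have h2 := levelOne_maj_eq 2; have h3 := levelOne_maj_eq 3; have h4 := levelOne_maj_eq 4
  have c1 : Nat.choose 2 1 = 2 := (by decide); have c2 : Nat.choose 4 2 = 6 := (by decide)
  have c3 : Nat.choose 6 3 = 20 := (by decide); have c4 : Nat.choose 8 4 = 70 := (by decide)
  norm_num [c1, c2, c3, c4] at h1 h2 h3 h4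
  exact ⟨h1, h2, h3, h4⟩

/-- **THE NOISE EDGES (T6, `norm_num` only)**: the base `W₁(Maj_m)(1−p)²` exceeds one for every `p ≤ 0.1835` (`m = 3`: the constant `1 − √(2/3) = 0.18350…` of `pauliPathTruncation_worstCase`, recovered as the width-3 case), every `p ≤ 0.2697` (`m = 5`; exact edge `1 − √(8/15) = 0.26970…`), every `p ≤ 0.3238` (`m = 7`; edge `1 − √(16/35) = 0.32387…`) and every `p ≤ 0.3625` (`m = 9`; edge `1 − √(128/315) = 0.36254…`). [cite: GonzalezGarciaCiracTrivedi2025PauliPathBeyondAverageQuantum, Lemma 6 (v) (p < 1 − √(2/3) for the width-3 block)] -/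
theorem noise_edges :
    (∀ p : ℝ, p ≤ 0.1835 → 1 < levelOne (maj 3) * (1 - p) ^ 2) ∧
    (∀ p : ℝ, p ≤ 0.2697 → 1 < levelOne (maj 5) * (1 - p) ^ 2) ∧
    (∀ p : ℝ, p ≤ 0.3238 → 1 < levelOne (maj 7) * (1 - p) ^ 2) ∧
    (∀ p : ℝ, p ≤ 0.3625 → 1 < levelOne (maj 9) * (1 - p) ^ 2) := by
  obtain ⟨h3, h5, h7, h9⟩ := levelOne_maj_values
  rw [h3, h5, h7, h9]
  refine ⟨fun p hp => ?_, fun p hp => ?_, fun p hp => ?_, fun p hp => ?_⟩ <;>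
    nlinarith [mul_nonneg (sub_nonneg.2 hp) (by linarith : (0 : ℝ) ≤ 1 - p)]

/-- **The base exceeds one as soon as `(r+1)(1−p)⁴ > 1`** (no asymptotic symbols): then `W₁(Maj_{2r+1})(1−p)² > 1`. [cite: GonzalezGarciaCiracTrivedi2025PauliPathBeyondAverageQuantum, Lemma 6 (v) (the base (3/2)(1−p)² of the width-3 block)] -/
theorem base_gt_one (r : ℕ) {p : ℝ} (hp1 : p < 1) (h : 1 < (r + 1 : ℝ) * (1 - p) ^ 4) :
    1 < levelOne (maj (2 * r + 1)) * (1 - p) ^ 2 := by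
  have hW2 := levelOne_maj_sq_ge r
  have hW0 : 0 ≤ levelOne (maj (2 * r + 1)) := by
    rw [levelOne_maj]
    exact mul_nonneg (inv_nonneg.2 (pow_nonneg (by norm_num) _)) (Finset.sum_nonneg fun c _ => abs_nonneg _)
  have hq : 0 < (1 - p) ^ 2 := by positivity
  have hq4 : ((1 - p) ^ 2) ^ 2 = (1 - p) ^ 4 := by ring
  have hsq : (1 : ℝ) ^ 2 < (levelOne (maj (2 * r + 1)) * (1 - p) ^ 2) ^ 2 := by
    rw [one_pow, mul_pow, hq4]; nlinarith
  exact lt_of_pow_lt_pow_left₀ 2 (mul_nonneg hW0 hq.le) hsq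

/-- **NO NOISE THRESHOLD BELOW ONE IN THE BLOCK-LAYER PRESENTATION (T7)**: for every rate `0 ≤ p < 1` and every odd width `m = 2r+1` with `(r+1)(1−p)⁴ > 1`, the base `W₁(Maj_m)(1−p)²` exceeds one, and for EVERY cut-off `ℓ` the weight-`ℓ` truncation of the noisy value of `O_{⌊ℓ/2⌋}` on `n = m⌊ℓ/2⌋` qubits after ONE layer of `Maj_m`-blocks errs by at least `(W₁(Maj_m)(1−p)²)^{⌊ℓ/2⌋} − 1` (a bound of the shape "`2^{Ω(ℓ)}` for all `p < 1`" with the width chosen after `p`; the width-3 constant `1 − √(2/3)` of `pauliPathTruncation_worstCase` is the `m = 3` member, not a threshold of this presentation). [cite: GonzalezGarciaCiracTrivedi2025PauliPathBeyondAverageQuantum, Thm 3 and Lemma 6 (v) ("2^{Ω(ℓ)}, ∀ p < 1 − √(2/3)")] -/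
theorem wide_majority_no_threshold (r : ℕ) (i₀ : Fin (2 * r + 1)) {p : ℝ} (hp0 : 0 ≤ p) (hp1 : p < 1)
    (h : 1 < (r + 1 : ℝ) * (1 - p) ^ 4) (ℓ : ℕ) :
    1 < levelOne (maj (2 * r + 1)) * (1 - p) ^ 2 ∧
    (levelOne (maj (2 * r + 1)) * (1 - p) ^ 2) ^ (ℓ / 2) - 1 ≤
      ‖noisyValue (p : ℂ) (wideLayers (maj (2 * r + 1)) i₀ (ℓ / 2)) (wideInput (2 * r + 1) (ℓ / 2))
            (pauliString (wideObs i₀ (ℓ / 2))) -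
          truncValue (p : ℂ) ℓ (wideLayers (maj (2 * r + 1)) i₀ (ℓ / 2)) (wideInput (2 * r + 1) (ℓ / 2))
            (pauliString (wideObs i₀ (ℓ / 2)))‖ :=
  ⟨base_gt_one r hp1 h,
    truncation_floor_sub_one (maj_odd ⟨r, rfl⟩) i₀ p hp0 hp1.le (ℓ / 2) ℓ (by omega) (by omega)⟩

/-! #### The width-3 member is GGCT's circuit; the width-5 falsifier -/

/-- The conditional complement of `Maj_3` into wire `0` is GGCT's `|100⟩ ↔ |011⟩`. [cite: GonzalezGarciaCiracTrivedi2025PauliPathBeyondAverageQuantum, Lemma 5 (the gate V)] -/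
theorem gateFlip_maj_three (b : Fin 3 → Bool) : gateFlip (maj 3) 0 b = majorityFlip b := by
  revert b; decide

/-- Hence `V_{Maj_3} = V`, GGCT's majority gate. [cite: GonzalezGarciaCiracTrivedi2025PauliPathBeyondAverageQuantum, Lemma 5 (the gate V)] -/
theorem gate_maj_three : gate (maj 3) 0 = majorityGate := by
  ext a b; rw [gate_apply, majorityGate_apply, gateFlip_maj_three]

/-- … and the wide circuit at width 3 is GGCT's `V^{⊗k}` on `|0^{3k}⟩` with `O_k = ∏ Z_{3i−2}` (definitionally for input and observable). [cite: GonzalezGarciaCiracTrivedi2025PauliPathBeyondAverageQuantum, Lemma 5 (𝒞, ρ_0, O_k)] -/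
theorem wideLayers_maj_three (k : ℕ) :
    wideLayers (maj 3) 0 k = layers k ∧ wideInput 3 k = input k ∧ wideObs (0 : Fin 3) k = obs k := by
  refine ⟨funext fun t => ?_, rfl, rfl⟩
  show (blockTensor fun _ : Fin k => gate (maj 3) 0) = layer k
  rw [gate_maj_three]; rfl

/-- **THE WIDTH-3 INSTANCE ON GGCT'S OWN OBJECTS, at the new cut-offs `ℓ ∈ {2k, 2k+1}` and for EVERY `0 ≤ p ≤ 1`**: `‖⟨O_k⟩_err − ⟨O_k⟩_ℓ‖ ≥ ((3/2)(1−p)²)^k − 1` — the constant of the barrier fact `pauliPathTruncation_worstCase` (which has the window `2k < ℓ ≤ 9k/4` and `p < 1 − √(2/3)`), recovered as the `m = 3` member of the family. [cite: GonzalezGarciaCiracTrivedi2025PauliPathBeyondAverageQuantum, Lemma 6 (v)] -/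
theorem width_three_floor (p : ℝ) (hp0 : 0 ≤ p) (hp1 : p ≤ 1) (k ℓ : ℕ) (h1 : 2 * k ≤ ℓ) (h2 : ℓ ≤ 2 * k + 1) :
    (3 / 2 * (1 - p) ^ 2) ^ k - 1 ≤
      ‖noisyValue (p : ℂ) (layers k) (input k) (pauliString (obs k)) -
          truncValue (p : ℂ) ℓ (layers k) (input k) (pauliString (obs k))‖ := by
  obtain ⟨hL, hI, hO⟩ := wideLayers_maj_three k
  rw [← hL, ← hI, ← hO, ← levelOne_maj_values.1]
  exact truncation_floor_sub_one (maj_odd (by decide)) 0 p hp0 hp1 k ℓ h1 h2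

/-- `∏_j (1 + x(−1)^{c_j}) = (1−x)^{|c|}(1+x)^{m−|c|}`. [folklore] -/
private theorem prod_one_add_mul_sgn (x : ℝ) (c : Fin m → Bool) :
    ∏ j, (1 + x * sgn (c j)) = (1 - x) ^ wt c * (1 + x) ^ (m - wt c) := by
  have h : ∀ j, (1 + x * sgn (c j)) = if c j = true then (1 - x) else (1 + x) := by
    intro j; unfold sgn; split_ifs <;> ring
  simp only [h]
  rw [Finset.prod_ite, Finset.prod_const, Finset.prod_const]
  have hc := Finset.card_filter_add_card_filter_not (s := (Finset.univ : Finset (Fin m))) (fun j => c j = true)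
  rw [Finset.card_univ, Fintype.card_fin] at hc
  rw [wt, show (Finset.univ.filter fun j => ¬ c j = true).card = m - (Finset.univ.filter fun j => c j = true).card by omega]

/-- The generating value of majority, grouped by the count: `A_{Maj_m}(x) = x·2^{−m} Σ_s C(m,s)·(∓1)·(1−x)^s(1+x)^{m−s}`. [cite: GonzalezGarciaCiracTrivedi2025PauliPathBeyondAverageQuantum, Lemma 6 (ii) (the width-3 value (3x² − x⁴)/2 at x = 1−p)] -/
theorem blockGen_maj (m : ℕ) (x : ℝ) : blockGen (maj m) x = x * (((2 : ℝ) ^ m)⁻¹ *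
    ∑ s ∈ Finset.range (m + 1), (m.choose s : ℝ) * ((if m < 2 * s then (-1 : ℝ) else 1) * ((1 - x) ^ s * (1 + x) ^ (m - s)))) := by
  have h : ∀ c : Fin m → Bool, sgn (maj m c) = if m < 2 * wt c then (-1 : ℝ) else 1 := by
    intro c; simp only [maj, sgn, decide_eq_true_eq]
  unfold blockGen
  simp only [prod_one_add_mul_sgn, h]
  rw [sum_by_wt (F := fun s => (if m < 2 * s then (-1 : ℝ) else 1) * ((1 - x) ^ s * (1 + x) ^ (m - s)))]

/-- **CHEAPEST FALSIFIER (width 5, one block)**: `A_{Maj_5}(x) = (15x² − 10x⁴ + 3x⁶)/8` against the window value `(15/8)x²`; at `x = 1 − p` the one-block truncation error is `|10x⁴ − 3x⁶|/8`, and `k` blocks raise the base `15x²/8`, which exceeds one for every `p ≤ 0.2697`. [cite: GonzalezGarciaCiracTrivedi2025PauliPathBeyondAverageQuantum, Lemma 6 (ii) (width 3: (3x² − x⁴)/2)] -/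
example (x : ℝ) : blockGen (maj 5) x = (15 * x ^ 2 - 10 * x ^ 4 + 3 * x ^ 6) / 8 := by
  have c0 : Nat.choose 5 0 = 1 := (by decide); have c1 : Nat.choose 5 1 = 5 := (by decide)
  have c2 : Nat.choose 5 2 = 10 := (by decide); have c3 : Nat.choose 5 3 = 10 := (by decide)
  have c4 : Nat.choose 5 4 = 5 := (by decide); have c5 : Nat.choose 5 5 = 1 := (by decide)
  rw [blockGen_maj]
  simp only [Finset.sum_range_succ, Finset.sum_range_zero, c0, c1, c2, c3, c4, c5]
  norm_num; ring

end WideMajorityTruncation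

end Literature.Computability.QuantumComplexity
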